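import Mathlib
import HarnessLib
import Summits.Ventures.LatticeQCDFlow.Exactness.U1DriftPlaquetteCalculus

/-!
# `U(1)` rung: the exact (autodiff) force PULLED BACK THROUGH ONE MASKED WILSON-FLOW SUB-STEP — the chain rule in closed form

HONEST FRAMING: exact (Metropolis-corrected) sampling algorithms for lattice gauge theory;
figures of merit are autocorrelation/cost numbers at stated couplings and volumes; no
continuum-physics claim.

Venture `LatticeQCDFlow` (cell pub-lqcd), topic `Exactness`; FANOUT row 14 (`eng-flowhmc`, engine
`latflow.fthmc`, family B, `U(1)` rung; the FT-HMC force is `κ · fderiv (p ↦ S̃(e^(icp)·V)) 0 (δ_e)`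
with `S̃ = S∘F − log J`, obtained by autodiff THROUGH the member).  NEW WORK of the cell over this
row's `U1DriftPlaquetteCalculus` (derivatives of plaquettes / `Z` / `C` along the drift); nothing is
cited as a fact; no number.  The
masked sub-step `f` (direction `μ`, class `b`, step `ε`) and its booked factor are VERBATIM as in
`exists_layers_u1WilsonFlowLO`:
`f(V)_e = V_e · exp(iε Z_e(V))` on active links, `J(V) = ∏_active (1 − ε C_a(V))`.

* §1 `u1Substep_circleDrift` — A SUB-STEP OF A DRIFTED FIELD IS A DRIFT OF THE SUB-STEPPED FIELD:
  `f(e^(icp)·V) = e^(icθ(p))·f(V)` with `θ(p)_e = p_e + [e active]·(ε/c)·(Z_e(e^(icp)·V) − Z_e(V))`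
  (`c ≠ 0`); `hasFDerivAt_u1SubstepPhase` — `θ` is Fréchet differentiable at `0` with derivative
  `T = pi (e ↦ proj_e + [e active]·(ε/c) • DZ_e)`, `DZ_e` the derivative of `Z_e` along the drift;
* §2 `u1FlowFieldDeriv_apply_single`, `u1FactorDeriv_apply_single` — the derivatives of `Z_e`, `C_e`
  along the drift evaluated on a basis vector `δ_e'`: `c · M_e(V)(e')`, `−c · N_e(V)(e')`, where
  `M`, `N` are the explicit INCIDENCE-WEIGHTED sums of `Re` / `Im` of the `2(d−1)` plaquettes
  through `e`;
* §3 `hasFDerivAt_comp_u1Substep_circleDrift` (chain rule) and **`u1ExactForce_comp_substep`** —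
  for ANY `S'` differentiable along the drift at the sub-stepped field, every `c, κ`, every `V, e'`:

    `g_(S'∘f)(V)(e') = g_(S')(fV)(e') + ε · Σ_(e active) M_e(V)(e') · g_(S')(fV)(e)`,

  `g_S(V)(e) = κ · fderiv (p ↦ S(e^(icp)·V)) 0 (δ_e)` the cell's exact force (the transpose of
  `Df = 1 + ε DZ` acting on the force at `fV`; `c = 0` gives `0 = 0`);
* the force of the booked log-Jacobian is the companion file `U1SubstepLogJacobianForce`.

NOT CLAIMED: bounds (`U1SubstepForceBounds`); `SU(2)`; floating point; any number.
-/

noncomputable section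

namespace Summit.Ventures.LatticeQCDFlow.Exactness

open Literature.MathematicalPhysics.QuantumFieldTheory
open scoped BigOperators

variable {d L : ℕ} {X : Type*} [DecidableEq X] (χ : Site d L → X)

/-! ## §1 A sub-step of a drifted field is a drift of the sub-stepped field -/

section Phase

/-- **`f(e^(icp)·V) = e^(icθ(p))·f(V)`**, `θ(p)_e = p_e + [e active]·(ε/c)·(Z_e(e^(icp)·V) − Z_e(V))`,
for `c ≠ 0`. -/
theorem u1Substep_circleDrift (μ : Fin d) (b : X) (ε : ℝ) {c : ℝ} (hc : c ≠ 0) (p : Edge d L → ℝ)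
    (V : GaugeConfig d L Circle) :
    (fun (V : GaugeConfig d L Circle) (e : Edge d L) => if e.2 = μ ∧ χ e.1 = b then
          V e * Circle.exp (ε * ∑ ν ∈ Finset.univ.erase e.2,
            (((plaquetteHolonomy V (e.1 - Pi.single ν 1) e.2 ν : Circle) : ℂ).im -
              ((plaquetteHolonomy V e.1 e.2 ν : Circle) : ℂ).im)) else V e)
        ((fun i : Edge d L => Circle.exp (c * p i)) * V) =
      (fun i : Edge d L => Circle.exp (c * (fun e : Edge d L => p e +
          (if e.2 = μ ∧ χ e.1 = b then ε / c else 0) *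
            ((∑ ν ∈ Finset.univ.erase e.2,
              (((plaquetteHolonomy ((fun i : Edge d L => Circle.exp (c * p i)) * V) (e.1 - Pi.single ν 1) e.2 ν : Circle) : ℂ).im -
                ((plaquetteHolonomy ((fun i : Edge d L => Circle.exp (c * p i)) * V) e.1 e.2 ν : Circle) : ℂ).im)) -
             ∑ ν ∈ Finset.univ.erase e.2,
              (((plaquetteHolonomy V (e.1 - Pi.single ν 1) e.2 ν : Circle) : ℂ).im -
                ((plaquetteHolonomy V e.1 e.2 ν : Circle) : ℂ).im))) i)) *
        (fun (V : GaugeConfig d L Circle) (e : Edge d L) => if e.2 = μ ∧ χ e.1 = b then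
          V e * Circle.exp (ε * ∑ ν ∈ Finset.univ.erase e.2,
            (((plaquetteHolonomy V (e.1 - Pi.single ν 1) e.2 ν : Circle) : ℂ).im -
              ((plaquetteHolonomy V e.1 e.2 ν : Circle) : ℂ).im)) else V e) V := by
  funext e
  simp only [Pi.mul_apply]
  by_cases he : e.2 = μ ∧ χ e.1 = b
  · simp only [if_pos he]
    set Z' : ℝ := ∑ ν ∈ Finset.univ.erase e.2,
        (((plaquetteHolonomy ((fun i : Edge d L => Circle.exp (c * p i)) * V) (e.1 - Pi.single ν 1) e.2 ν : Circle) : ℂ).im -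
          ((plaquetteHolonomy ((fun i : Edge d L => Circle.exp (c * p i)) * V) e.1 e.2 ν : Circle) : ℂ).im)
    set Z : ℝ := ∑ ν ∈ Finset.univ.erase e.2,
        (((plaquetteHolonomy V (e.1 - Pi.single ν 1) e.2 ν : Circle) : ℂ).im -
          ((plaquetteHolonomy V e.1 e.2 ν : Circle) : ℂ).im)
    have harg : c * (p e + ε / c * (Z' - Z)) = c * p e + ε * Z' - ε * Z := by
      field_simp
      ring
    rw [harg, Circle.exp_sub, Circle.exp_add]
    apply Circle.ext
    simp only [Circle.coe_mul, Circle.coe_div]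
    have h1 : ((Circle.exp (ε * Z) : Circle) : ℂ) ≠ 0 := Circle.coe_ne_zero _
    field_simp
  · simp only [if_neg he, zero_mul, add_zero]

variable [NeZero L]

/-- **The phase map `θ` is Fréchet differentiable at `p = 0`** with derivative
`pi (e ↦ proj_e + [e active]·(ε/c) • DZ_e)`, `DZ_e` the derivative of `Z_e` along the drift
(`hasFDerivAt_u1FlowField_circleDrift`). -/
theorem hasFDerivAt_u1SubstepPhase (μ : Fin d) (b : X) (ε c : ℝ) (V : GaugeConfig d L Circle) :
    HasFDerivAt (fun (p : Edge d L → ℝ) (e : Edge d L) => p e +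
          (if e.2 = μ ∧ χ e.1 = b then ε / c else 0) *
            ((∑ ν ∈ Finset.univ.erase e.2,
              (((plaquetteHolonomy ((fun i : Edge d L => Circle.exp (c * p i)) * V) (e.1 - Pi.single ν 1) e.2 ν : Circle) : ℂ).im -
                ((plaquetteHolonomy ((fun i : Edge d L => Circle.exp (c * p i)) * V) e.1 e.2 ν : Circle) : ℂ).im)) -
             ∑ ν ∈ Finset.univ.erase e.2,
              (((plaquetteHolonomy V (e.1 - Pi.single ν 1) e.2 ν : Circle) : ℂ).im -
                ((plaquetteHolonomy V e.1 e.2 ν : Circle) : ℂ).im)))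
      (ContinuousLinearMap.pi fun e : Edge d L =>
        ContinuousLinearMap.proj (R := ℝ) (φ := fun _ : Edge d L => ℝ) e +
          (if e.2 = μ ∧ χ e.1 = b then ε / c else 0) •
            ∑ ν ∈ Finset.univ.erase e.2,
              ((c * ((plaquetteHolonomy V (e.1 - Pi.single ν 1) e.2 ν : Circle) : ℂ).re) •
                (ContinuousLinearMap.proj (R := ℝ) (φ := fun _ : Edge d L => ℝ) (e.1 - Pi.single ν 1, e.2) +
                  ContinuousLinearMap.proj (R := ℝ) (φ := fun _ : Edge d L => ℝ) ((e.1 - Pi.single ν 1).shift e.2, ν) -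
                  ContinuousLinearMap.proj (R := ℝ) (φ := fun _ : Edge d L => ℝ) ((e.1 - Pi.single ν 1).shift ν, e.2) -
                  ContinuousLinearMap.proj (R := ℝ) (φ := fun _ : Edge d L => ℝ) (e.1 - Pi.single ν 1, ν)) -
              (c * ((plaquetteHolonomy V e.1 e.2 ν : Circle) : ℂ).re) •
                (ContinuousLinearMap.proj (R := ℝ) (φ := fun _ : Edge d L => ℝ) (e.1, e.2) +
                  ContinuousLinearMap.proj (R := ℝ) (φ := fun _ : Edge d L => ℝ) (e.1.shift e.2, ν) -
                  ContinuousLinearMap.proj (R := ℝ) (φ := fun _ : Edge d L => ℝ) (e.1.shift ν, e.2) -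
                  ContinuousLinearMap.proj (R := ℝ) (φ := fun _ : Edge d L => ℝ) (e.1, ν)))) 0 := by
  refine hasFDerivAt_pi.2 fun e => ?_
  exact (hasFDerivAt_apply e (0 : Edge d L → ℝ)).add
    (((hasFDerivAt_u1FlowField_circleDrift c V e).sub_const _).const_mul _)

omit [NeZero L] in
/-- At `p = 0` the phase map vanishes. -/
theorem u1SubstepPhase_zero (μ : Fin d) (b : X) (ε c : ℝ) (V : GaugeConfig d L Circle) :
    (fun (p : Edge d L → ℝ) (e : Edge d L) => p e +
          (if e.2 = μ ∧ χ e.1 = b then ε / c else 0) *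
            ((∑ ν ∈ Finset.univ.erase e.2,
              (((plaquetteHolonomy ((fun i : Edge d L => Circle.exp (c * p i)) * V) (e.1 - Pi.single ν 1) e.2 ν : Circle) : ℂ).im -
                ((plaquetteHolonomy ((fun i : Edge d L => Circle.exp (c * p i)) * V) e.1 e.2 ν : Circle) : ℂ).im)) -
             ∑ ν ∈ Finset.univ.erase e.2,
              (((plaquetteHolonomy V (e.1 - Pi.single ν 1) e.2 ν : Circle) : ℂ).im -
                ((plaquetteHolonomy V e.1 e.2 ν : Circle) : ℂ).im))) 0 = 0 := by
  funext e
  beta_reduce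
  rw [circleDrift_zero]
  simp only [Pi.zero_apply, sub_self, mul_zero, add_zero]

end Phase

/-! ## §2 The derivatives of `Z_e`, `C_e` along the drift on a basis vector -/

section Apply

variable [NeZero L]

omit [NeZero L] in
/-- **`DZ_e(δ_e') = c · M_e(V)(e')`**, `M_e(V)(e') = Σ_ν [Re P(V;x−ν̂,μ,ν)·ℓ_(x−ν̂,μ,ν)(δ_e') − Re P(V;x,μ,ν)·ℓ_(x,μ,ν)(δ_e')]`. -/
theorem u1FlowFieldDeriv_apply_single (c : ℝ) (V : GaugeConfig d L Circle) (e e' : Edge d L) :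
    (∑ ν ∈ Finset.univ.erase e.2,
        ((c * ((plaquetteHolonomy V (e.1 - Pi.single ν 1) e.2 ν : Circle) : ℂ).re) •
          (ContinuousLinearMap.proj (R := ℝ) (φ := fun _ : Edge d L => ℝ) (e.1 - Pi.single ν 1, e.2) +
            ContinuousLinearMap.proj (R := ℝ) (φ := fun _ : Edge d L => ℝ) ((e.1 - Pi.single ν 1).shift e.2, ν) -
            ContinuousLinearMap.proj (R := ℝ) (φ := fun _ : Edge d L => ℝ) ((e.1 - Pi.single ν 1).shift ν, e.2) -
            ContinuousLinearMap.proj (R := ℝ) (φ := fun _ : Edge d L => ℝ) (e.1 - Pi.single ν 1, ν)) -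
        (c * ((plaquetteHolonomy V e.1 e.2 ν : Circle) : ℂ).re) •
          (ContinuousLinearMap.proj (R := ℝ) (φ := fun _ : Edge d L => ℝ) (e.1, e.2) +
            ContinuousLinearMap.proj (R := ℝ) (φ := fun _ : Edge d L => ℝ) (e.1.shift e.2, ν) -
            ContinuousLinearMap.proj (R := ℝ) (φ := fun _ : Edge d L => ℝ) (e.1.shift ν, e.2) -
            ContinuousLinearMap.proj (R := ℝ) (φ := fun _ : Edge d L => ℝ) (e.1, ν))))
        (Pi.single e' (1 : ℝ)) =
      c * ∑ ν ∈ Finset.univ.erase e.2,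
        (((plaquetteHolonomy V (e.1 - Pi.single ν 1) e.2 ν : Circle) : ℂ).re *
            ((Pi.single e' (1 : ℝ) : Edge d L → ℝ) (e.1 - Pi.single ν 1, e.2) +
              (Pi.single e' (1 : ℝ) : Edge d L → ℝ) ((e.1 - Pi.single ν 1).shift e.2, ν) -
              (Pi.single e' (1 : ℝ) : Edge d L → ℝ) ((e.1 - Pi.single ν 1).shift ν, e.2) -
              (Pi.single e' (1 : ℝ) : Edge d L → ℝ) (e.1 - Pi.single ν 1, ν)) -
          ((plaquetteHolonomy V e.1 e.2 ν : Circle) : ℂ).re *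
            ((Pi.single e' (1 : ℝ) : Edge d L → ℝ) (e.1, e.2) +
              (Pi.single e' (1 : ℝ) : Edge d L → ℝ) (e.1.shift e.2, ν) -
              (Pi.single e' (1 : ℝ) : Edge d L → ℝ) (e.1.shift ν, e.2) -
              (Pi.single e' (1 : ℝ) : Edge d L → ℝ) (e.1, ν))) := by
  rw [sum_apply, Finset.mul_sum]
  refine Finset.sum_congr rfl fun ν _ => ?_
  rw [sub_apply, smul_apply, smul_apply, incidence_apply, incidence_apply, smul_eq_mul, smul_eq_mul]
  ring

omit [NeZero L] in
/-- **`DC_e(δ_e') = −c · N_e(V)(e')`**, `N_e(V)(e') = Σ_ν [Im P(V;x,μ,ν)·ℓ_(x,μ,ν)(δ_e') + Im P(V;x−ν̂,μ,ν)·ℓ_(x−ν̂,μ,ν)(δ_e')]`. -/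
theorem u1FactorDeriv_apply_single (c : ℝ) (V : GaugeConfig d L Circle) (e e' : Edge d L) :
    (∑ ν ∈ Finset.univ.erase e.2,
        ((-(c * ((plaquetteHolonomy V e.1 e.2 ν : Circle) : ℂ).im)) •
          (ContinuousLinearMap.proj (R := ℝ) (φ := fun _ : Edge d L => ℝ) (e.1, e.2) +
            ContinuousLinearMap.proj (R := ℝ) (φ := fun _ : Edge d L => ℝ) (e.1.shift e.2, ν) -
            ContinuousLinearMap.proj (R := ℝ) (φ := fun _ : Edge d L => ℝ) (e.1.shift ν, e.2) -
            ContinuousLinearMap.proj (R := ℝ) (φ := fun _ : Edge d L => ℝ) (e.1, ν)) +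
        (-(c * ((plaquetteHolonomy V (e.1 - Pi.single ν 1) e.2 ν : Circle) : ℂ).im)) •
          (ContinuousLinearMap.proj (R := ℝ) (φ := fun _ : Edge d L => ℝ) (e.1 - Pi.single ν 1, e.2) +
            ContinuousLinearMap.proj (R := ℝ) (φ := fun _ : Edge d L => ℝ) ((e.1 - Pi.single ν 1).shift e.2, ν) -
            ContinuousLinearMap.proj (R := ℝ) (φ := fun _ : Edge d L => ℝ) ((e.1 - Pi.single ν 1).shift ν, e.2) -
            ContinuousLinearMap.proj (R := ℝ) (φ := fun _ : Edge d L => ℝ) (e.1 - Pi.single ν 1, ν))))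
        (Pi.single e' (1 : ℝ)) =
      -(c * ∑ ν ∈ Finset.univ.erase e.2,
        (((plaquetteHolonomy V e.1 e.2 ν : Circle) : ℂ).im *
            ((Pi.single e' (1 : ℝ) : Edge d L → ℝ) (e.1, e.2) +
              (Pi.single e' (1 : ℝ) : Edge d L → ℝ) (e.1.shift e.2, ν) -
              (Pi.single e' (1 : ℝ) : Edge d L → ℝ) (e.1.shift ν, e.2) -
              (Pi.single e' (1 : ℝ) : Edge d L → ℝ) (e.1, ν)) +
          ((plaquetteHolonomy V (e.1 - Pi.single ν 1) e.2 ν : Circle) : ℂ).im *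
            ((Pi.single e' (1 : ℝ) : Edge d L → ℝ) (e.1 - Pi.single ν 1, e.2) +
              (Pi.single e' (1 : ℝ) : Edge d L → ℝ) ((e.1 - Pi.single ν 1).shift e.2, ν) -
              (Pi.single e' (1 : ℝ) : Edge d L → ℝ) ((e.1 - Pi.single ν 1).shift ν, e.2) -
              (Pi.single e' (1 : ℝ) : Edge d L → ℝ) (e.1 - Pi.single ν 1, ν)))) := by
  rw [sum_apply, Finset.mul_sum, ← Finset.sum_neg_distrib]
  refine Finset.sum_congr rfl fun ν _ => ?_
  rw [add_apply, smul_apply, smul_apply, incidence_apply, incidence_apply, smul_eq_mul, smul_eq_mul]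
  ring

end Apply

/-! ## §3 The chain rule through one sub-step and the pulled-back force in closed form -/

section Chain

variable [NeZero L]

/-- **Chain rule**: if `p ↦ S'(e^(icp)·f(V))` has Fréchet derivative `φ` at `0`, then
`p ↦ S'(f(e^(icp)·V))` has derivative `φ ∘ T` at `0` (`c ≠ 0`, `T` from `hasFDerivAt_u1SubstepPhase`). -/
theorem hasFDerivAt_comp_u1Substep_circleDrift (μ : Fin d) (b : X) (ε : ℝ) {c : ℝ} (hc : c ≠ 0)
    (V : GaugeConfig d L Circle) {S' : GaugeConfig d L Circle → ℝ} {φ : (Edge d L → ℝ) →L[ℝ] ℝ}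
    (hS' : HasFDerivAt (fun p : Edge d L → ℝ => S' ((fun i : Edge d L => Circle.exp (c * p i)) *
        (fun (V : GaugeConfig d L Circle) (e : Edge d L) => if e.2 = μ ∧ χ e.1 = b then
          V e * Circle.exp (ε * ∑ ν ∈ Finset.univ.erase e.2,
            (((plaquetteHolonomy V (e.1 - Pi.single ν 1) e.2 ν : Circle) : ℂ).im -
              ((plaquetteHolonomy V e.1 e.2 ν : Circle) : ℂ).im)) else V e) V)) φ 0) :
    HasFDerivAt (fun p : Edge d L → ℝ => S' ((fun (V : GaugeConfig d L Circle) (e : Edge d L) =>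
        if e.2 = μ ∧ χ e.1 = b then
          V e * Circle.exp (ε * ∑ ν ∈ Finset.univ.erase e.2,
            (((plaquetteHolonomy V (e.1 - Pi.single ν 1) e.2 ν : Circle) : ℂ).im -
              ((plaquetteHolonomy V e.1 e.2 ν : Circle) : ℂ).im)) else V e)
        ((fun i : Edge d L => Circle.exp (c * p i)) * V)))
      (φ.comp (ContinuousLinearMap.pi fun e : Edge d L =>
        ContinuousLinearMap.proj (R := ℝ) (φ := fun _ : Edge d L => ℝ) e +
          (if e.2 = μ ∧ χ e.1 = b then ε / c else 0) •
            ∑ ν ∈ Finset.univ.erase e.2,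
              ((c * ((plaquetteHolonomy V (e.1 - Pi.single ν 1) e.2 ν : Circle) : ℂ).re) •
                (ContinuousLinearMap.proj (R := ℝ) (φ := fun _ : Edge d L => ℝ) (e.1 - Pi.single ν 1, e.2) +
                  ContinuousLinearMap.proj (R := ℝ) (φ := fun _ : Edge d L => ℝ) ((e.1 - Pi.single ν 1).shift e.2, ν) -
                  ContinuousLinearMap.proj (R := ℝ) (φ := fun _ : Edge d L => ℝ) ((e.1 - Pi.single ν 1).shift ν, e.2) -
                  ContinuousLinearMap.proj (R := ℝ) (φ := fun _ : Edge d L => ℝ) (e.1 - Pi.single ν 1, ν)) -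
              (c * ((plaquetteHolonomy V e.1 e.2 ν : Circle) : ℂ).re) •
                (ContinuousLinearMap.proj (R := ℝ) (φ := fun _ : Edge d L => ℝ) (e.1, e.2) +
                  ContinuousLinearMap.proj (R := ℝ) (φ := fun _ : Edge d L => ℝ) (e.1.shift e.2, ν) -
                  ContinuousLinearMap.proj (R := ℝ) (φ := fun _ : Edge d L => ℝ) (e.1.shift ν, e.2) -
                  ContinuousLinearMap.proj (R := ℝ) (φ := fun _ : Edge d L => ℝ) (e.1, ν))))) 0 := by
  have hθ := hasFDerivAt_u1SubstepPhase χ μ b ε c V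
  have hθ0 := u1SubstepPhase_zero χ μ b ε c V
  -- the composite, rewritten through §1
  have hcomp : (fun p : Edge d L → ℝ => S' ((fun (V : GaugeConfig d L Circle) (e : Edge d L) =>
        if e.2 = μ ∧ χ e.1 = b then
          V e * Circle.exp (ε * ∑ ν ∈ Finset.univ.erase e.2,
            (((plaquetteHolonomy V (e.1 - Pi.single ν 1) e.2 ν : Circle) : ℂ).im -
              ((plaquetteHolonomy V e.1 e.2 ν : Circle) : ℂ).im)) else V e)
        ((fun i : Edge d L => Circle.exp (c * p i)) * V))) =
      (fun q : Edge d L → ℝ => S' ((fun i : Edge d L => Circle.exp (c * q i)) *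
        (fun (V : GaugeConfig d L Circle) (e : Edge d L) => if e.2 = μ ∧ χ e.1 = b then
          V e * Circle.exp (ε * ∑ ν ∈ Finset.univ.erase e.2,
            (((plaquetteHolonomy V (e.1 - Pi.single ν 1) e.2 ν : Circle) : ℂ).im -
              ((plaquetteHolonomy V e.1 e.2 ν : Circle) : ℂ).im)) else V e) V)) ∘
      (fun (p : Edge d L → ℝ) (e : Edge d L) => p e +
          (if e.2 = μ ∧ χ e.1 = b then ε / c else 0) *
            ((∑ ν ∈ Finset.univ.erase e.2,
              (((plaquetteHolonomy ((fun i : Edge d L => Circle.exp (c * p i)) * V) (e.1 - Pi.single ν 1) e.2 ν : Circle) : ℂ).im -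
                ((plaquetteHolonomy ((fun i : Edge d L => Circle.exp (c * p i)) * V) e.1 e.2 ν : Circle) : ℂ).im)) -
             ∑ ν ∈ Finset.univ.erase e.2,
              (((plaquetteHolonomy V (e.1 - Pi.single ν 1) e.2 ν : Circle) : ℂ).im -
                ((plaquetteHolonomy V e.1 e.2 ν : Circle) : ℂ).im))) := by
    funext p
    exact congrArg S' (u1Substep_circleDrift χ μ b ε hc p V)
  rw [hcomp]
  rw [← hθ0] at hS'
  exact HasFDerivAt.comp (0 : Edge d L → ℝ) hS' hθ

set_option maxHeartbeats 400000 in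
/-- **THE EXACT FORCE PULLED BACK THROUGH ONE MASKED SUB-STEP, IN CLOSED FORM.**  For every `S'`
differentiable along the drift at `f(V)`, every `c, κ`, every `V` and `e'`:
`g_(S'∘f)(V)(e') = g_(S')(fV)(e') + ε · Σ_(e active) M_e(V)(e') · g_(S')(fV)(e)`. -/
theorem u1ExactForce_comp_substep (μ : Fin d) (b : X) (ε c κ : ℝ) (V : GaugeConfig d L Circle)
    {S' : GaugeConfig d L Circle → ℝ}
    (hS' : DifferentiableAt ℝ (fun p : Edge d L → ℝ => S' ((fun i : Edge d L => Circle.exp (c * p i)) *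
        (fun (V : GaugeConfig d L Circle) (e : Edge d L) => if e.2 = μ ∧ χ e.1 = b then
          V e * Circle.exp (ε * ∑ ν ∈ Finset.univ.erase e.2,
            (((plaquetteHolonomy V (e.1 - Pi.single ν 1) e.2 ν : Circle) : ℂ).im -
              ((plaquetteHolonomy V e.1 e.2 ν : Circle) : ℂ).im)) else V e) V)) 0) (e' : Edge d L) :
    κ * fderiv ℝ (fun p : Edge d L → ℝ => S' ((fun (V : GaugeConfig d L Circle) (e : Edge d L) =>
        if e.2 = μ ∧ χ e.1 = b then
          V e * Circle.exp (ε * ∑ ν ∈ Finset.univ.erase e.2,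
            (((plaquetteHolonomy V (e.1 - Pi.single ν 1) e.2 ν : Circle) : ℂ).im -
              ((plaquetteHolonomy V e.1 e.2 ν : Circle) : ℂ).im)) else V e)
        ((fun i : Edge d L => Circle.exp (c * p i)) * V))) 0 (Pi.single e' 1) =
      κ * fderiv ℝ (fun p : Edge d L → ℝ => S' ((fun i : Edge d L => Circle.exp (c * p i)) *
        (fun (V : GaugeConfig d L Circle) (e : Edge d L) => if e.2 = μ ∧ χ e.1 = b then
          V e * Circle.exp (ε * ∑ ν ∈ Finset.univ.erase e.2,
            (((plaquetteHolonomy V (e.1 - Pi.single ν 1) e.2 ν : Circle) : ℂ).im -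
              ((plaquetteHolonomy V e.1 e.2 ν : Circle) : ℂ).im)) else V e) V)) 0 (Pi.single e' 1) +
      ε * ∑ e ∈ Finset.univ.filter (fun e : Edge d L => e.2 = μ ∧ χ e.1 = b),
        (∑ ν ∈ Finset.univ.erase e.2,
          (((plaquetteHolonomy V (e.1 - Pi.single ν 1) e.2 ν : Circle) : ℂ).re *
              ((Pi.single e' (1 : ℝ) : Edge d L → ℝ) (e.1 - Pi.single ν 1, e.2) +
                (Pi.single e' (1 : ℝ) : Edge d L → ℝ) ((e.1 - Pi.single ν 1).shift e.2, ν) -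
                (Pi.single e' (1 : ℝ) : Edge d L → ℝ) ((e.1 - Pi.single ν 1).shift ν, e.2) -
                (Pi.single e' (1 : ℝ) : Edge d L → ℝ) (e.1 - Pi.single ν 1, ν)) -
            ((plaquetteHolonomy V e.1 e.2 ν : Circle) : ℂ).re *
              ((Pi.single e' (1 : ℝ) : Edge d L → ℝ) (e.1, e.2) +
                (Pi.single e' (1 : ℝ) : Edge d L → ℝ) (e.1.shift e.2, ν) -
                (Pi.single e' (1 : ℝ) : Edge d L → ℝ) (e.1.shift ν, e.2) -
                (Pi.single e' (1 : ℝ) : Edge d L → ℝ) (e.1, ν)))) *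
        (κ * fderiv ℝ (fun p : Edge d L → ℝ => S' ((fun i : Edge d L => Circle.exp (c * p i)) *
          (fun (V : GaugeConfig d L Circle) (e : Edge d L) => if e.2 = μ ∧ χ e.1 = b then
            V e * Circle.exp (ε * ∑ ν ∈ Finset.univ.erase e.2,
              (((plaquetteHolonomy V (e.1 - Pi.single ν 1) e.2 ν : Circle) : ℂ).im -
                ((plaquetteHolonomy V e.1 e.2 ν : Circle) : ℂ).im)) else V e) V)) 0 (Pi.single e 1)) := by
  classical
  by_cases hc : c = 0
  · -- `c = 0`: both drifted functions are constant, every force vanishes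
    subst hc
    have h0 : ∀ (p : Edge d L → ℝ) (W : GaugeConfig d L Circle),
        (fun i : Edge d L => Circle.exp (0 * p i)) * W = W := by
      intro p W
      funext i
      simp only [Pi.mul_apply, zero_mul, Circle.exp_zero, one_mul]
    simp only [h0, fderiv_const_apply, zero_apply, mul_zero, Finset.sum_const_zero, add_zero]
  -- `c ≠ 0`: the chain rule, then evaluate `φ ∘ T` on the basis vector
  set φ : (Edge d L → ℝ) →L[ℝ] ℝ := fderiv ℝ (fun p : Edge d L → ℝ => S' ((fun i : Edge d L => Circle.exp (c * p i)) *
        (fun (V : GaugeConfig d L Circle) (e : Edge d L) => if e.2 = μ ∧ χ e.1 = b then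
          V e * Circle.exp (ε * ∑ ν ∈ Finset.univ.erase e.2,
            (((plaquetteHolonomy V (e.1 - Pi.single ν 1) e.2 ν : Circle) : ℂ).im -
              ((plaquetteHolonomy V e.1 e.2 ν : Circle) : ℂ).im)) else V e) V)) 0 with hφ_def
  have hchain := hasFDerivAt_comp_u1Substep_circleDrift χ μ b ε hc V hS'.hasFDerivAt
  rw [hchain.fderiv, ContinuousLinearMap.comp_apply]
  -- the vector `T(δ_e')`
  set w : Edge d L → ℝ := (ContinuousLinearMap.pi fun e : Edge d L =>
        ContinuousLinearMap.proj (R := ℝ) (φ := fun _ : Edge d L => ℝ) e +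
          (if e.2 = μ ∧ χ e.1 = b then ε / c else 0) •
            ∑ ν ∈ Finset.univ.erase e.2,
              ((c * ((plaquetteHolonomy V (e.1 - Pi.single ν 1) e.2 ν : Circle) : ℂ).re) •
                (ContinuousLinearMap.proj (R := ℝ) (φ := fun _ : Edge d L => ℝ) (e.1 - Pi.single ν 1, e.2) +
                  ContinuousLinearMap.proj (R := ℝ) (φ := fun _ : Edge d L => ℝ) ((e.1 - Pi.single ν 1).shift e.2, ν) -
                  ContinuousLinearMap.proj (R := ℝ) (φ := fun _ : Edge d L => ℝ) ((e.1 - Pi.single ν 1).shift ν, e.2) -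
                  ContinuousLinearMap.proj (R := ℝ) (φ := fun _ : Edge d L => ℝ) (e.1 - Pi.single ν 1, ν)) -
              (c * ((plaquetteHolonomy V e.1 e.2 ν : Circle) : ℂ).re) •
                (ContinuousLinearMap.proj (R := ℝ) (φ := fun _ : Edge d L => ℝ) (e.1, e.2) +
                  ContinuousLinearMap.proj (R := ℝ) (φ := fun _ : Edge d L => ℝ) (e.1.shift e.2, ν) -
                  ContinuousLinearMap.proj (R := ℝ) (φ := fun _ : Edge d L => ℝ) (e.1.shift ν, e.2) -
                  ContinuousLinearMap.proj (R := ℝ) (φ := fun _ : Edge d L => ℝ) (e.1, ν))))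
      (Pi.single e' (1 : ℝ)) with hw_def
  -- its coordinates
  have hw : ∀ e : Edge d L, w e = (Pi.single e' (1 : ℝ) : Edge d L → ℝ) e +
      (if e.2 = μ ∧ χ e.1 = b then ε / c else 0) * (c * ∑ ν ∈ Finset.univ.erase e.2,
        (((plaquetteHolonomy V (e.1 - Pi.single ν 1) e.2 ν : Circle) : ℂ).re *
            ((Pi.single e' (1 : ℝ) : Edge d L → ℝ) (e.1 - Pi.single ν 1, e.2) +
              (Pi.single e' (1 : ℝ) : Edge d L → ℝ) ((e.1 - Pi.single ν 1).shift e.2, ν) -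
              (Pi.single e' (1 : ℝ) : Edge d L → ℝ) ((e.1 - Pi.single ν 1).shift ν, e.2) -
              (Pi.single e' (1 : ℝ) : Edge d L → ℝ) (e.1 - Pi.single ν 1, ν)) -
          ((plaquetteHolonomy V e.1 e.2 ν : Circle) : ℂ).re *
            ((Pi.single e' (1 : ℝ) : Edge d L → ℝ) (e.1, e.2) +
              (Pi.single e' (1 : ℝ) : Edge d L → ℝ) (e.1.shift e.2, ν) -
              (Pi.single e' (1 : ℝ) : Edge d L → ℝ) (e.1.shift ν, e.2) -
              (Pi.single e' (1 : ℝ) : Edge d L → ℝ) (e.1, ν)))) := by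
    intro e
    rw [hw_def, ContinuousLinearMap.pi_apply, add_apply, ContinuousLinearMap.proj_apply, smul_apply,
      u1FlowFieldDeriv_apply_single, smul_eq_mul]
  -- expand `φ w` along the basis
  have hexp : φ w = ∑ e : Edge d L, w e * φ (Pi.single e (1 : ℝ)) := by
    conv_lhs => rw [pi_eq_sum_univ' w]
    rw [map_sum]
    refine Finset.sum_congr rfl fun e _ => ?_
    rw [map_smul, smul_eq_mul]
  rw [hexp]
  simp_rw [hw, add_mul, Finset.sum_add_distrib]
  -- the identity part
  have hid : ∑ e : Edge d L, (Pi.single e' (1 : ℝ) : Edge d L → ℝ) e * φ (Pi.single e (1 : ℝ)) =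
      φ (Pi.single e' (1 : ℝ)) := by
    have hs : ∀ e : Edge d L, (Pi.single e' (1 : ℝ) : Edge d L → ℝ) e * φ (Pi.single e (1 : ℝ)) =
        if e = e' then φ (Pi.single e' (1 : ℝ)) else 0 := by
      intro e
      rw [Pi.single_apply]
      split_ifs with h
      · rw [h, one_mul]
      · rw [zero_mul]
    simp_rw [hs]
    rw [Finset.sum_ite_eq' Finset.univ e', if_pos (Finset.mem_univ _)]
  rw [hid, mul_add]
  congr 1
  -- the active part: indicator sum = filtered sum, and `(ε / c) · c = ε`
  rw [Finset.sum_filter, Finset.mul_sum, Finset.mul_sum]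
  refine Finset.sum_congr rfl fun e _ => ?_
  split_ifs with he
  · field_simp
  · simp

end Chain

end Summit.Ventures.LatticeQCDFlow.Exactness
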